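import Summits.BirchSwinnertonDyer.BirchSwinnertonDyer.Theorems.Rank1ResidualJetKolyvaginClassOrder
import Literature.NumberTheory.EllipticCurves.SelmerTorsionInclusion
import Summits.BirchSwinnertonDyer.Rank1Residual.X11b.Three.KolyvaginLine
import HarnessLib

/-!
# The LEVEL-`p` AVATAR `κ̄_n` of the Kolyvagin class `c_{M+1}(n)` when `p^M ∣ P_n` — the object of the swap supply's
# `κ̄` dictionary — and its two defining properties IN THE KERNEL: `ι_* κ̄_n = c_{M+1}(n)` and
# «`κ̄_n = 0 ↔ p^{M+1} ∣ P_n`» (cell `bsd-stepL`, seat `bsd-stepL-corner-p1` g8; `--supports stmt-BirchSwinnertonDyer-19947`)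

WHAT. The prime swap (`…KolyJSwap`, `…KolyJSwapRowPrime`) runs at level `p` on classes `κ̄_n ∈ H¹(K, E[p])`; the supplier
must provide them together with `hκ0 : κ̄_n ≠ 0 ↔ P_n ∉ p^{M+1}E(K[n])`, their sign∕local conditions and Prop. 4.4.
BCGS (Prop. 2.2.1) take `κ̄_n :=` the class `c_{M+1}(n) ∈ 𝔪^M H¹ ⊆ H¹[𝔪] ≅ H¹(K, E[p])`. This file CONSTRUCTS `κ̄_n`
without any exact sequence: with `P_n = p^M Q_n` (`Q_n ∈ E(K[n])`, unique as `E(K[n])` has no `p`-torsion), `κ̄_n` is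
McCallum's level-`p` class OF THE POINT `Q_n` — the cocycle `g ↦ g(Q_n/p) − Q_n/p − (g−1)Q_n/p` is LITERALLY the cocycle of
`c_{M+1}(n)` (`P_n/p^{M+1} := Q_n/p`, and `(g−1)P_n/p^{M+1} = (g−1)Q_n/p` by uniqueness of roots in `E(K[n])`).
* §1 **`torsionH1OfDvd_kolyvaginClass_of_zsmul`** (generic curve over a field, any `d ∣ n = m·d`): the change-of-level map
  `ι_* : H¹(K, E[d]) → H¹(K, E[n])` sends McCallum's level-`d` class of `Q` to the level-`n` class of `m • Q` (same
  admissible `A`).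
* §2 **`exists_levelOne_avatar`** (Kolyvagin–Heegner data, tree currency): for a datum `d` of conductor `n` with
  `E(K[n]) ⊆ E(K̄)` admissible for `p^{M+1}` and `[P_n]` invariant mod `p^{M+1}` (the standing inputs of every class file:
  Gross Lemma 4.3 ∕ Prop. 3.6), and `p^M ∣ P_n`: there is `κ̄ ∈ H¹(K, E[p])` with `ι_* κ̄ = c_{M+1}(n)` and
  `κ̄ = 0 ↔ p^{M+1} ∣ P_n`.
So of the swap supply's `κ̄` dictionary, `hκ0` is now KERNEL (given the standing inputs), and every statement about `κ̄_n`
that is invariant under the injective `ι_*` (`E(K)[p] = 0`: `torsionH1OfDvd_pow_injective…`) — sign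
(`conjAct_torsionH1OfDvd`), local vanishing at Kolyvagin primes (`mem_torsionLocalKer_iff_torsionH1OfDvd_mem`), Kummer
conditions (`torsionH1ToH1_torsionH1OfDvd`) — REDUCES to the same statement about `c_{M+1}(n)`, i.e. to the walk's
currency (Prop. 4.4 = h47-type, Selmer membership = hselmer-type). HONEST FRAMING: theorems only, no definition ∕ fact ∕
sorry; nothing about any particular curve; no stub closes; T7.
References: [McCallumLMS1991] §4 Lemma 4.1, (6), Cor. 4.5, Lemma 4.6; [GrossLMS1991] §4 (4.4)–(4.6), Prop. 4.7 (1);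
[BurungaleEtAl2026] Prop. 2.2.1 (the reduced classes `κ̄`).
-/

set_option autoImplicit false

noncomputable section

open scoped Classical

open WeierstrassCurve Field NumberField IsDedekindDomain
  Literature.NumberTheory.EllipticCurves Literature.NumberTheory.EllipticCurves.ModularForms
  Literature.NumberTheory.EllipticCurves.KolyvaginCocycle
  Literature.NumberTheory.GaloisRepresentations
  Summit.BirchSwinnertonDyer.Rank1Residual.X11b
  Summit.BirchSwinnertonDyer.Rank1Residual.X11b.Three

universe u

namespace Summit.BirchSwinnertonDyer.Rank1Residual.X11b.Three.Koly

/-! ### §1 Change of level on McCallum's classes -/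

section Generic

variable {K : Type u} [Field K] (W : WeierstrassCurve K)

/-- **`ι_* c_d(Q) = c_n(m • Q)`** (`n = m·d`): the change-of-level map `H¹(K, E[d]) → H¹(K, E[n])` sends McCallum's level-`d`
class of `Q` (admissible `A ∋ Q`, `[Q]` invariant mod `dA`) to the level-`n` class of `m • Q` — both are represented by the
SAME cocycle `g ↦ gQ₁ − Q₁ − (g−1)Q/d` (`dQ₁ = Q`; `(g−1)(mQ)/n = (g−1)Q/d` by uniqueness of roots in `A`). McCallum's
Lemma 4.6 (`p^{M'} d_M(n) = d_{M−M'}(n)`) is the same bookkeeping on the `H¹(K, E)` side.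
[cite: McCallumLMS1991, §4 Lemma 4.1, (6), Lemma 4.6] [cite: GrossLMS1991, §4 (4.4), (4.6)] -/
theorem torsionH1OfDvd_kolyvaginClass_of_zsmul {d n m : ℤ} (hdn : d ∣ n) (hnm : n = m * d)
    (hdivd : ∀ P : geomPoints W, ∃ Q : geomPoints W, d • Q = P)
    (hdivn : ∀ P : geomPoints W, ∃ Q : geomPoints W, n • Q = P)
    {A : AddSubgroup (geomPoints W)}
    (hAd : IsAdmissible (absoluteGaloisGroup K) A d) (hAn : IsAdmissible (absoluteGaloisGroup K) A n)
    {Q : geomPoints W} (hQ : Q ∈ invPoints (absoluteGaloisGroup K) A d)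
    {P : geomPoints W} (hPQ : m • Q = P) (hP : P ∈ invPoints (absoluteGaloisGroup K) A n) :
    torsionH1OfDvd W hdn (kolyvaginClass W d hdivd hAd Q hQ) = kolyvaginClass W n hdivn hAn P hP := by
  obtain ⟨Q₁, hQ₁⟩ := hdivd Q
  have hP₁ : n • Q₁ = P := by rw [hnm, mul_smul, hQ₁, hPQ]
  rw [kolyvaginClass_eq_cls hAd hQ hQ₁, kolyvaginClass_eq_cls hAn hP hP₁]
  unfold KolyvaginCocycle.cls
  change ContinuousCohomology.map (ContinuousMonoidHom.id (absoluteGaloisGroup K))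
      (resHomOfEquivariant (ContinuousMonoidHom.id (absoluteGaloisGroup K))
        (AddSubgroup.inclusion (geomTorsion_le_of_dvd W hdn)) fun _ _ ↦ rfl) 1
      (oneCocycleClass _ (cocycle hAd (continuous_smul_geomPoints W) hQ hQ₁)) =
    oneCocycleClass _ (cocycle hAn (continuous_smul_geomPoints W) hP hP₁)
  rw [map_oneCocycleClass]
  refine oneCocycleClass_congr_val fun g ↦ ?_
  change ((AddSubgroup.inclusion (geomTorsion_le_of_dvd W hdn)
      ((cocycle hAd (continuous_smul_geomPoints W) hQ hQ₁).1 g) : geomTorsion W n) : geomPoints W) =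
    ((cocycle hAn (continuous_smul_geomPoints W) hP hP₁).1 g : geomPoints W)
  rw [AddSubgroup.coe_inclusion, coe_cocycle_apply, coe_cocycle_apply]
  congr 1
  -- the roots agree: `(g−1)P/n = (g−1)Q/d`
  obtain ⟨hRmem, hR⟩ := rootIn_spec (A := A) (n := d) (hQ.2 g)
  symm
  refine rootIn_eq hAn.eq_zero_of_zsmul hRmem ?_
  rw [hnm, mul_smul, hR, ← hPQ, smul_sub, smul_zsmul_comm]

end Generic

/-! ### §2 The level-`p` avatar of `c_{M+1}(n)` on Kolyvagin–Heegner data -/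

section Avatar

variable {K : Type} [Field K] [NumberField K] {N : ℕ} [NeZero N] {W : WeierstrassCurve ℚ}
  {Dt : ModularParametrizationData W N} {β : ℤ} {ι : K →+* ℂ} {n : ℕ}

/-- Admissibility for `p^{M+1}` gives admissibility for `p` (a `p`-torsion element of `A` is `p^{M+1}`-torsion). [folklore] -/
theorem isAdmissible_of_pow_succ (d : KolyvaginHeegnerData Dt β ι n) {p M : ℕ}
    (hA : IsAdmissible (absoluteGaloisGroup K) d.pointsSubgroup ((p ^ (M + 1) : ℕ) : ℤ)) :
    IsAdmissible (absoluteGaloisGroup K) d.pointsSubgroup ((p : ℕ) : ℤ) := by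
  refine ⟨hA.smul_mem, fun a ha h ↦ hA.eq_zero_of_zsmul ha ?_⟩
  rw [pow_succ, Nat.cast_mul, mul_smul, h, smul_zero]

/-- No `p^j`-torsion in an admissible `A` for `p^{M+1}`, `j ≤ M + 1`. [folklore] -/
theorem eq_zero_of_pow_zsmul_of_isAdmissible (d : KolyvaginHeegnerData Dt β ι n) {p M : ℕ}
    (hA : IsAdmissible (absoluteGaloisGroup K) d.pointsSubgroup ((p ^ (M + 1) : ℕ) : ℤ))
    {j : ℕ} (hj : j ≤ M + 1) {a : geomPoints (W.baseChange K)} (ha : a ∈ d.pointsSubgroup)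
    (h : ((p ^ j : ℕ) : ℤ) • a = 0) : a = 0 := by
  refine hA.eq_zero_of_zsmul ha ?_
  obtain ⟨i, hi⟩ := Nat.exists_eq_add_of_le hj
  rw [hi, pow_add, Nat.cast_mul, mul_comm, mul_smul, h, smul_zero]

/-- **The level-`p` avatar.** For a Kolyvagin–Heegner datum `d` of conductor `n`, a prime `p` and `M`, on the standing inputs
`hA` (`E(K[n]) ⊆ E(K̄)` admissible for `p^{M+1}`: Gross Lemma 4.3) and `hP` (`[P_n]` invariant mod `p^{M+1}`: Gross
Prop. 3.6), if `p^M ∣ P_n` then there is `κ̄ ∈ H¹(K, E[p])` with `ι_* κ̄ = c_{M+1}(n)` (`torsionH1OfDvd`) and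
`κ̄ = 0 ↔ p^{M+1} ∣ P_n`. Construction: `P_n = p^M Q`, `κ̄ := c_p(Q)` (McCallum's level-`p` class of the point `Q`);
§1 gives `ι_* κ̄ = c_{M+1}(n)`; Cor. 4.5 for `Q` (`kolyvaginClass_eq_zero_iff` at `N = Gal(K̄/K[n])`) gives
`κ̄ = 0 ↔ Q ∈ pE(K[n]) ↔ P_n ∈ p^{M+1}E(K[n])` (no `p`-torsion). This is the object `κ̄_n` of BCGS Prop. 2.2.1's proof and
of the swap supply (`…KolyJSwapRowPrime`, input `κb` with `hκ0`). [cite: McCallumLMS1991, §4 Lemma 4.1, Cor. 4.5, Lemma 4.6]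
[cite: BurungaleEtAl2026, Prop. 2.2.1 (§2.2)] [cite: GrossLMS1991, Prop. 4.7 (1)] -/
theorem exists_levelOne_avatar (d : KolyvaginHeegnerData Dt β ι n) {p : ℕ} (hp : p.Prime) (M : ℕ)
    (hA : IsAdmissible (absoluteGaloisGroup K) d.pointsSubgroup ((p ^ (M + 1) : ℕ) : ℤ))
    (hP : d.toGeomPoints d.derivedPoint ∈
      invPoints (absoluteGaloisGroup K) d.pointsSubgroup ((p ^ (M + 1) : ℕ) : ℤ))
    (hdiv : PDiv d p M) :
    ∃ κb : galH1Torsion (W.baseChange K) ((p ^ 1 : ℕ) : ℤ),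
      torsionH1OfDvd (W.baseChange K) (by exact_mod_cast pow_dvd_pow p (Nat.le_add_left 1 M)) κb =
          d.kolyvaginClass hp (M + 1) ∧
      (κb = 0 ↔ PDiv d p (M + 1)) := by
  -- `P_n = p^M Q` with `Q ∈ E(K[n])`
  obtain ⟨Q, hQ⟩ := hdiv
  set Qg : geomPoints (W.baseChange K) := d.toGeomPoints Q with hQg
  have hQgA : Qg ∈ d.pointsSubgroup := ⟨Q, rfl⟩
  have hPQ : ((p ^ M : ℕ) : ℤ) • Qg = d.toGeomPoints d.derivedPoint := by rw [hQg, ← map_zsmul, hQ]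
  -- admissibility at level `p` (written `p^1`)
  have hA1 : IsAdmissible (absoluteGaloisGroup K) d.pointsSubgroup ((p ^ 1 : ℕ) : ℤ) := by
    refine ⟨hA.smul_mem, fun a ha h ↦ eq_zero_of_pow_zsmul_of_isAdmissible d hA (j := 1) (by omega) ha h⟩
  -- `[Q]` is invariant mod `p A`
  have hQinv : Qg ∈ invPoints (absoluteGaloisGroup K) d.pointsSubgroup ((p ^ 1 : ℕ) : ℤ) := by
    refine ⟨hQgA, fun g ↦ ?_⟩
    obtain ⟨R, hR, hRe⟩ := hP.2 g
    refine ⟨R, hR, ?_⟩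
    -- `p^M (p R − (gQ − Q)) = 0` in `A`, and `A` has no `p^M`-torsion
    have hmem : ((p ^ 1 : ℕ) : ℤ) • R - (g • Qg - Qg) ∈ d.pointsSubgroup :=
      d.pointsSubgroup.sub_mem (d.pointsSubgroup.zsmul_mem hR _)
        (d.pointsSubgroup.sub_mem (hA.smul_mem g hQgA) hQgA)
    have h0 : ((p ^ M : ℕ) : ℤ) • (((p ^ 1 : ℕ) : ℤ) • R - (g • Qg - Qg)) = 0 := by
      rw [smul_sub, smul_smul, ← Nat.cast_mul, ← pow_add, hRe, smul_sub, ← smul_zsmul_comm, hPQ, sub_self]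
    exact sub_eq_zero.mp (eq_zero_of_pow_zsmul_of_isAdmissible d hA (j := M) (by omega) hmem h0)
  -- the avatar
  have hdiv1 := (W.baseChange K).zsmul_geomPoints_surjective_of_charZero (n := ((p ^ 1 : ℕ) : ℤ))
    (by exact_mod_cast pow_ne_zero 1 hp.ne_zero)
  refine ⟨kolyvaginClass (W.baseChange K) ((p ^ 1 : ℕ) : ℤ) hdiv1 hA1 Qg hQinv, ?_, ?_⟩
  · -- `ι_* κ̄ = c_{M+1}(n)` by §1
    rw [d.kolyvaginClass_of_admissible hp (M + 1) hA hP]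
    exact torsionH1OfDvd_kolyvaginClass_of_zsmul (W.baseChange K) _ (by push_cast; ring) hdiv1 _ hA1 hA
      hQinv hPQ hP
  · -- `κ̄ = 0 ↔ Q ∈ p E(K[n]) ↔ p^{M+1} ∣ P_n`
    rw [kolyvaginClass_eq_zero_iff hA1 hQinv
      (N := {g : absoluteGaloisGroup K | ∀ x : ringClassField K ι n,
        (show AlgebraicClosure K ≃ₐ[K] AlgebraicClosure K from g) (d.emb x) = d.emb x})
      (fun g hg ↦ KolyCert.smul_toGeomPoints_of_forall_emb d g hg _)
      (fun v hv ↦ KolyCert.mem_pointsSubgroup_of_forall_smul_eq d v fun g hg ↦ hv g hg)]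
    constructor
    · rintro ⟨_, ⟨Q', rfl⟩, hQ'⟩
      refine ⟨Q', ?_⟩
      apply (WeierstrassCurve.Affine.Point.map_injective (W' := W) (f := d.emb.toRatAlgHom))
      change d.toGeomPoints (((p ^ (M + 1) : ℕ) : ℤ) • Q') = d.toGeomPoints d.derivedPoint
      rw [map_zsmul, ← hPQ, ← hQ', smul_smul, ← Nat.cast_mul, pow_one, ← pow_succ]
    · rintro ⟨Q', hQ'⟩
      refine ⟨d.toGeomPoints Q', ⟨Q', rfl⟩, ?_⟩
      -- `p^M (p Q' − Q) = 0` in `E(K[n])`, no `p`-power torsion there (transported along `toGeomPoints`)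
      have h0 : ((p ^ M : ℕ) : ℤ) • (((p ^ 1 : ℕ) : ℤ) • d.toGeomPoints Q' - Qg) = 0 := by
        rw [smul_sub, smul_smul, ← Nat.cast_mul, ← pow_add, hPQ, ← map_zsmul,
          show M + 1 = M + 1 from rfl, hQ', sub_self]
      have hmem : ((p ^ 1 : ℕ) : ℤ) • d.toGeomPoints Q' - Qg ∈ d.pointsSubgroup :=
        d.pointsSubgroup.sub_mem (d.pointsSubgroup.zsmul_mem ⟨Q', rfl⟩ _) hQgA
      exact sub_eq_zero.mp (eq_zero_of_pow_zsmul_of_isAdmissible d hA (j := M) (by omega) hmem h0)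

end Avatar

end Summit.BirchSwinnertonDyer.Rank1Residual.X11b.Three.Koly

end
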